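import Literature.MathematicalPhysics.QuantumManyBody.SwapPurity
import Literature.MathematicalPhysics.QuantumManyBody.BoseGasCatStates
import Mathlib.MeasureTheory.Function.L2Space
import Mathlib.Analysis.InnerProductSpace.Basic

/-!
# Route `BECThomsonPrinciple`, crux `PeriodicToDirichlet` (stmt-AtomisticToContinuum-9483),
# line `entropy-swap`: registered stub `stub_flatnessTransfer`

The pure Hilbert-space *flatness transfer* step of the one-bath design of the line. For a bath
configuration `Y ∈ (ℝ³)ⁿ` write `g = G(· :: Y)`, `f = F(· :: Y)` for the slices of two wave
functions `G, F ∈ L²((ℝ³)^{n+1})` and `φ₀ = constantMode L` for the normalised indicator of the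
cell `[0, L)³`. The conditional flatness of a slice is `κ(f) = |⟨φ₀, f⟩|² / ‖f‖²`. If
`κ(g) ≥ κ` and the mixed overlap `τ = |⟨g, f⟩|² / (‖g‖² ‖f‖²) ≥ 1 - κ/16` (`0 ≤ κ ≤ 1`), then
`κ(f) ≥ κ/4`.

Proof. Everything happens in the span of `e = φ₀`, `u = f/‖f‖`, `w = g/‖g‖` (unit vectors of
`L²(ℝ³)`): decompose `u = ⟨w, u⟩ w + r` with `r ⊥ w`, `‖r‖² = 1 - |⟨w, u⟩|² ≤ κ/16`; then
`⟨e, u⟩ = ⟨w, u⟩⟨e, w⟩ + ⟨e, r⟩`, so `|⟨e, u⟩| ≥ |⟨w, u⟩| |⟨e, w⟩| - ‖r‖`, and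
`(|⟨w, u⟩| |⟨e, w⟩|)² ≥ (1 - κ/16) κ ≥ 15κ/16 ≥ 15 ‖r‖²`, whence `|⟨e, u⟩| ≥ (2/3)|⟨w, u⟩||⟨e, w⟩|`
and `κ(f) = |⟨e, u⟩|² ≥ (4/9)(15/16) κ ≥ κ/4`. The abstract inequality is proved in an arbitrary
complex inner product space (`ft_transfer`) and instantiated in `Lp ℂ 2` (`ft_functions`); the
degenerate cases are excluded by `τ > 0`, which forces `⟨g, f⟩ ≠ 0`, hence `f, g ≠ 0` in `L²`.
Everything here is [folklore].
-/

noncomputable section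

namespace Summit.AtomisticToContinuum.BoseEinsteinCondensation.EntropySwap

open Literature.MathematicalPhysics.QuantumManyBody.BoseGas
open MeasureTheory
open scoped ENNReal NNReal ComplexConjugate InnerProductSpace

/-! ### The abstract transfer inequality in a complex inner product space -/

section Hilbert

variable {E : Type*} [NormedAddCommGroup E] [InnerProductSpace ℂ E]

/-- For unit vectors `u, w`, the residual `r = u - ⟨w, u⟩ w` of the orthogonal projection of `u`
on `w` has `‖r‖² = 1 - |⟨w, u⟩|²`. [folklore] -/
theorem ft_norm_sub_proj_sq (u w : E) (hu : ‖u‖ = 1) (hw : ‖w‖ = 1) :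
    ‖u - ⟪w, u⟫_ℂ • w‖ ^ 2 = 1 - ‖⟪w, u⟫_ℂ‖ ^ 2 := by
  have hre : RCLike.re (⟪w, u⟫_ℂ * conj ⟪w, u⟫_ℂ) = ‖⟪w, u⟫_ℂ‖ ^ 2 := by
    rw [Complex.mul_conj', ← Complex.ofReal_pow, RCLike.re_to_complex, Complex.ofReal_re]
  rw [norm_sub_sq (𝕜 := ℂ), inner_smul_right, ← inner_conj_symm u w, hre, norm_smul, hu, hw]
  ring

/-- **Alignment through a near-parallel pair** (unit vectors `e, u, w`):
`|⟨e, u⟩| ≥ |⟨w, u⟩| |⟨e, w⟩| - ‖u - ⟨w, u⟩ w‖` — decompose `u = ⟨w, u⟩ w + r` and use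
Cauchy–Schwarz on `⟨e, r⟩`. [folklore] -/
theorem ft_norm_inner_ge (e u w : E) (he : ‖e‖ = 1) :
    ‖⟪w, u⟫_ℂ‖ * ‖⟪e, w⟫_ℂ‖ - ‖u - ⟪w, u⟫_ℂ • w‖ ≤ ‖⟪e, u⟫_ℂ‖ := by
  have hdec : ⟪e, u⟫_ℂ = ⟪w, u⟫_ℂ * ⟪e, w⟫_ℂ + ⟪e, u - ⟪w, u⟫_ℂ • w⟫_ℂ := by
    rw [inner_sub_right, inner_smul_right]
    ring
  have h1 : ‖⟪w, u⟫_ℂ * ⟪e, w⟫_ℂ‖ ≤ ‖⟪e, u⟫_ℂ‖ + ‖⟪e, u - ⟪w, u⟫_ℂ • w⟫_ℂ‖ := by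
    rw [hdec]
    exact norm_le_add_norm_add _ _
  have h2 : ‖⟪e, u - ⟪w, u⟫_ℂ • w⟫_ℂ‖ ≤ ‖u - ⟪w, u⟫_ℂ • w‖ := by
    calc ‖⟪e, u - ⟪w, u⟫_ℂ • w⟫_ℂ‖ ≤ ‖e‖ * ‖u - ⟪w, u⟫_ℂ • w‖ := norm_inner_le_norm _ _
      _ = ‖u - ⟪w, u⟫_ℂ • w‖ := by rw [he, one_mul]
  rw [norm_mul] at h1
  linarith

/-- **Flatness transfer, unit vectors**: if `|⟨e, w⟩|² ≥ κ` and `|⟨w, u⟩|² ≥ 1 - κ/16`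
(`0 ≤ κ ≤ 1`, `e, u, w` unit vectors), then `|⟨e, u⟩|² ≥ κ/4`. [folklore] -/
theorem ft_unit_transfer (e u w : E) (he : ‖e‖ = 1) (hu : ‖u‖ = 1) (hw : ‖w‖ = 1) {κ : ℝ}
    (hκ0 : 0 ≤ κ) (hκ1 : κ ≤ 1) (h1 : κ ≤ ‖⟪e, w⟫_ℂ‖ ^ 2) (h2 : 1 - κ / 16 ≤ ‖⟪w, u⟫_ℂ‖ ^ 2) :
    κ / 4 ≤ ‖⟪e, u⟫_ℂ‖ ^ 2 := by
  have hA := ft_norm_inner_ge e u w he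
  have hs := ft_norm_sub_proj_sq u w hu hw
  set p := ‖⟪w, u⟫_ℂ‖ with hp
  set q := ‖⟪e, w⟫_ℂ‖ with hq
  set a := ‖⟪e, u⟫_ℂ‖ with ha
  set s := ‖u - ⟪w, u⟫_ℂ • w‖ with hs'
  have hp0 : 0 ≤ p := norm_nonneg _
  have hq0 : 0 ≤ q := norm_nonneg _
  have hs2 : s ^ 2 ≤ κ / 16 := by rw [hs]; linarith
  have hκ2 : κ * κ ≤ κ * 1 := mul_le_mul_of_nonneg_left hκ1 hκ0
  have hpq2 : 15 * κ / 16 ≤ (p * q) ^ 2 := by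
    rw [mul_pow]
    calc 15 * κ / 16 ≤ (1 - κ / 16) * κ := by nlinarith
      _ ≤ p ^ 2 * q ^ 2 := mul_le_mul h2 h1 hκ0 (sq_nonneg _)
  have h3s : 3 * s ≤ p * q := by
    have h9 : (3 * s) ^ 2 ≤ (p * q) ^ 2 := by nlinarith
    exact (abs_le_of_sq_le_sq' h9 (mul_nonneg hp0 hq0)).2
  have h23 : 2 * (p * q) / 3 ≤ a := by linarith
  have hsq : (2 * (p * q) / 3) ^ 2 ≤ a ^ 2 :=
    pow_le_pow_left₀ (by positivity) h23 2
  nlinarith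

/-- **Flatness transfer** (nonzero `f, g`, unit `e`): if `|⟨e, g⟩|²/‖g‖² ≥ κ` and
`|⟨g, f⟩|²/(‖g‖² ‖f‖²) ≥ 1 - κ/16` (`0 ≤ κ ≤ 1`), then `|⟨e, f⟩|²/‖f‖² ≥ κ/4` — the unit-vector
statement for `u = f/‖f‖`, `w = g/‖g‖`. [folklore] -/
theorem ft_transfer (e f g : E) (he : ‖e‖ = 1) (hf : f ≠ 0) (hg : g ≠ 0) {κ : ℝ} (hκ0 : 0 ≤ κ)
    (hκ1 : κ ≤ 1) (h1 : κ ≤ ‖⟪e, g⟫_ℂ‖ ^ 2 / ‖g‖ ^ 2)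
    (h2 : 1 - κ / 16 ≤ ‖⟪g, f⟫_ℂ‖ ^ 2 / (‖g‖ ^ 2 * ‖f‖ ^ 2)) :
    κ / 4 ≤ ‖⟪e, f⟫_ℂ‖ ^ 2 / ‖f‖ ^ 2 := by
  have hf0 : 0 < ‖f‖ := norm_pos_iff.mpr hf
  have hg0 : 0 < ‖g‖ := norm_pos_iff.mpr hg
  set u : E := ((‖f‖⁻¹ : ℝ) : ℂ) • f with hu
  set w : E := ((‖g‖⁻¹ : ℝ) : ℂ) • g with hw
  have hnu : ‖u‖ = 1 := by
    rw [hu, norm_smul, Complex.norm_real, norm_inv, norm_norm, inv_mul_cancel₀ hf0.ne']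
  have hnw : ‖w‖ = 1 := by
    rw [hw, norm_smul, Complex.norm_real, norm_inv, norm_norm, inv_mul_cancel₀ hg0.ne']
  have heu : ‖⟪e, u⟫_ℂ‖ ^ 2 = ‖⟪e, f⟫_ℂ‖ ^ 2 / ‖f‖ ^ 2 := by
    rw [hu, inner_smul_right, norm_mul, Complex.norm_real, norm_inv, norm_norm, mul_pow, inv_pow,
      inv_mul_eq_div]
  have hew : ‖⟪e, w⟫_ℂ‖ ^ 2 = ‖⟪e, g⟫_ℂ‖ ^ 2 / ‖g‖ ^ 2 := by
    rw [hw, inner_smul_right, norm_mul, Complex.norm_real, norm_inv, norm_norm, mul_pow, inv_pow,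
      inv_mul_eq_div]
  have hwu : ‖⟪w, u⟫_ℂ‖ ^ 2 = ‖⟪g, f⟫_ℂ‖ ^ 2 / (‖g‖ ^ 2 * ‖f‖ ^ 2) := by
    rw [hu, hw, inner_smul_left, inner_smul_right, Complex.conj_ofReal, norm_mul, norm_mul,
      Complex.norm_real, Complex.norm_real, norm_inv, norm_inv, norm_norm, norm_norm]
    field_simp
  rw [← heu]
  rw [← hew] at h1
  rw [← hwu] at h2
  exact ft_unit_transfer e u w he hnu hnw hκ0 hκ1 h1 h2

end Hilbert

/-! ### From `L²` functions to the Hilbert space `Lp ℂ 2` -/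

section LTwo

variable {α : Type*} [MeasurableSpace α] {μ : Measure α}

/-- `∫ |f|² = ‖f‖_{L²}²` in `ℝ≥0∞` (the `lintegral` of `‖f‖₊²` is the square of `eLpNorm f 2`).
[folklore] -/
theorem ft_lintegral_sq_eq_eLpNorm_sq (f : α → ℂ) :
    ∫⁻ a, (‖f a‖₊ : ℝ≥0∞) ^ 2 ∂μ = eLpNorm f 2 μ ^ 2 := by
  rw [eLpNorm_eq_eLpNorm' two_ne_zero ENNReal.ofNat_ne_top, ENNReal.toReal_ofNat,
    ← ENNReal.rpow_two, ← lintegral_rpow_enorm_eq_rpow_eLpNorm' zero_lt_two]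
  refine lintegral_congr fun a => ?_
  rw [ENNReal.rpow_two, enorm_eq_nnnorm]

/-- An a.e.-strongly measurable `f` with `∫ |f|² < ∞` is in `L²`. [folklore] -/
theorem ft_memLp_two {f : α → ℂ} (hf : AEStronglyMeasurable f μ)
    (h2 : ∫⁻ a, (‖f a‖₊ : ℝ≥0∞) ^ 2 ∂μ ≠ ⊤) : MemLp f 2 μ := by
  refine ⟨hf, ?_⟩
  have h : eLpNorm f 2 μ ^ 2 < ⊤ := by
    rw [← ft_lintegral_sq_eq_eLpNorm_sq]
    exact h2.lt_top
  exact (ENNReal.pow_lt_top_iff.1 h).resolve_right two_ne_zero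

/-- `‖f‖_{L²}² = (∫ |f|²).toReal` for the class of `f` in `Lp ℂ 2`. [folklore] -/
theorem ft_norm_toLp_sq {f : α → ℂ} (hf : MemLp f 2 μ) :
    ‖hf.toLp f‖ ^ 2 = (∫⁻ a, (‖f a‖₊ : ℝ≥0∞) ^ 2 ∂μ).toReal := by
  rw [Lp.norm_toLp, ← ENNReal.toReal_pow, ft_lintegral_sq_eq_eLpNorm_sq]

/-- The `L²` inner product of two classes is the pairing `∫ conj f · g`. [folklore] -/
theorem ft_inner_toLp {f g : α → ℂ} (hf : MemLp f 2 μ) (hg : MemLp g 2 μ) :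
    ⟪hf.toLp f, hg.toLp g⟫_ℂ = ∫ a, conj (f a) * g a ∂μ := by
  rw [L2.inner_def]
  refine integral_congr_ae ?_
  filter_upwards [hf.coeFn_toLp, hg.coeFn_toLp] with a ha hb
  rw [ha, hb, RCLike.inner_apply']

/-- Conversion of the `ℝ≥0∞`-valued ratio bound `ofReal r ≤ |z|² / B` (`B ≠ 0`) to the real
inequality `r ≤ |z|² / B.toReal` (both sides read `r ≤ 0` if `B = ∞`). [folklore] -/
theorem ft_ofReal_le_div_iff {r : ℝ} {z : ℂ} {B : ℝ≥0∞} (hB0 : B ≠ 0) :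
    ENNReal.ofReal r ≤ (‖z‖₊ : ℝ≥0∞) ^ 2 / B ↔ r ≤ ‖z‖ ^ 2 / B.toReal := by
  rw [ENNReal.ofReal_le_iff_le_toReal
      (ENNReal.div_ne_top (ENNReal.pow_ne_top ENNReal.coe_ne_top) hB0),
    ENNReal.toReal_div, ENNReal.toReal_pow, ENNReal.coe_toReal, coe_nnnorm]

/-- **Flatness transfer for `L²` functions** (`e` normalised, `f, g ∈ L²`, all ratios in
`ℝ≥0∞`): `κ ≤ |⟨e, g⟩|²/‖g‖²` and `1 - κ/16 ≤ |⟨g, f⟩|²/(‖g‖² ‖f‖²)` imply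
`κ/4 ≤ |⟨e, f⟩|²/‖f‖²` (`0 ≤ κ ≤ 1`). The second hypothesis forces `⟨g, f⟩ ≠ 0`, hence
`f, g ≠ 0` in `L²`, and the statement is `ft_transfer` in `Lp ℂ 2 μ`. [folklore] -/
theorem ft_functions {e f g : α → ℂ} (he : AEStronglyMeasurable e μ)
    (hf : AEStronglyMeasurable f μ) (hg : AEStronglyMeasurable g μ)
    (he1 : ∫⁻ a, (‖e a‖₊ : ℝ≥0∞) ^ 2 ∂μ = 1) (hf2 : ∫⁻ a, (‖f a‖₊ : ℝ≥0∞) ^ 2 ∂μ ≠ ⊤)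
    (hg2 : ∫⁻ a, (‖g a‖₊ : ℝ≥0∞) ^ 2 ∂μ ≠ ⊤) {κ : ℝ} (hκ0 : 0 ≤ κ) (hκ1 : κ ≤ 1)
    (h1 : ENNReal.ofReal κ ≤
      (‖∫ a, conj (e a) * g a ∂μ‖₊ : ℝ≥0∞) ^ 2 / ∫⁻ a, (‖g a‖₊ : ℝ≥0∞) ^ 2 ∂μ)
    (h2 : ENNReal.ofReal (1 - κ / 16) ≤
      (‖∫ a, conj (g a) * f a ∂μ‖₊ : ℝ≥0∞) ^ 2 /
        ((∫⁻ a, (‖g a‖₊ : ℝ≥0∞) ^ 2 ∂μ) * ∫⁻ a, (‖f a‖₊ : ℝ≥0∞) ^ 2 ∂μ)) :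
    ENNReal.ofReal (κ / 4) ≤
      (‖∫ a, conj (e a) * f a ∂μ‖₊ : ℝ≥0∞) ^ 2 / ∫⁻ a, (‖f a‖₊ : ℝ≥0∞) ^ 2 ∂μ := by
  -- lift to `L²`
  have heL : MemLp e 2 μ := ft_memLp_two he (by rw [he1]; exact ENNReal.one_ne_top)
  have hfL : MemLp f 2 μ := ft_memLp_two hf hf2
  have hgL : MemLp g 2 μ := ft_memLp_two hg hg2
  have hEn : ‖heL.toLp e‖ = 1 := by
    have h := ft_norm_toLp_sq heL
    rw [he1, ENNReal.toReal_one] at h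
    rw [← Real.sqrt_sq (norm_nonneg (heL.toLp e)), h, Real.sqrt_one]
  have hFn := ft_norm_toLp_sq hfL
  have hGn := ft_norm_toLp_sq hgL
  have hEF := ft_inner_toLp heL hfL
  have hEG := ft_inner_toLp heL hgL
  have hGF := ft_inner_toLp hgL hfL
  -- non-degeneracy: `⟨g, f⟩ ≠ 0`
  have hGF0 : ⟪hgL.toLp g, hfL.toLp f⟫_ℂ ≠ 0 := by
    intro h0
    have hpos : 0 < ENNReal.ofReal (1 - κ / 16) := ENNReal.ofReal_pos.2 (by linarith)
    refine (ENNReal.div_pos_iff.1 (hpos.trans_le h2)).1 ?_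
    rw [← hGF, h0, nnnorm_zero, ENNReal.coe_zero, zero_pow two_ne_zero]
  have hF0 : hfL.toLp f ≠ 0 := fun h => hGF0 (by rw [h, inner_zero_right])
  have hG0 : hgL.toLp g ≠ 0 := fun h => hGF0 (by rw [h, inner_zero_left])
  have hf0 : ∫⁻ a, (‖f a‖₊ : ℝ≥0∞) ^ 2 ∂μ ≠ 0 := by
    intro h
    have hn : 0 < ‖hfL.toLp f‖ ^ 2 := pow_pos (norm_pos_iff.mpr hF0) 2
    rw [hFn, h, ENNReal.toReal_zero] at hn
    exact lt_irrefl _ hn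
  have hg0 : ∫⁻ a, (‖g a‖₊ : ℝ≥0∞) ^ 2 ∂μ ≠ 0 := by
    intro h
    have hn : 0 < ‖hgL.toLp g‖ ^ 2 := pow_pos (norm_pos_iff.mpr hG0) 2
    rw [hGn, h, ENNReal.toReal_zero] at hn
    exact lt_irrefl _ hn
  -- convert to real inequalities and apply the abstract transfer
  rw [ft_ofReal_le_div_iff hf0, ← hFn, ← hEF]
  rw [ft_ofReal_le_div_iff hg0, ← hGn, ← hEG] at h1
  rw [ft_ofReal_le_div_iff (mul_ne_zero hg0 hf0), ENNReal.toReal_mul, ← hGn, ← hFn, ← hGF] at h2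
  exact ft_transfer _ _ _ hEn hF0 hG0 hκ0 hκ1 h1 h2

end LTwo

/-! ### The registered stub -/

/-- **Stub `stub_flatnessTransfer`** of line `entropy-swap` (crux `PeriodicToDirichlet`): the
conditional flatness `κ(f) = |⟨φ₀, f⟩|²/‖f‖²` (`φ₀ = constantMode L`) of the slice
`f = F(· :: Y)` is at least `κ/4` as soon as the slice `g = G(· :: Y)` has flatness `≥ κ` and
the two slices overlap to `|⟨g, f⟩|²/(‖g‖² ‖f‖²) ≥ 1 - κ/16` (`0 ≤ κ ≤ 1`; slices measurable and
in `L²`, `L > 0`). [folklore] -/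
theorem stub_flatnessTransfer :
    ∀ (n : ℕ) (L : ℝ) (G F : Config (n + 1) → ℂ) (Y : Config n), Measurable G → Measurable F →
      0 < L →
      (∫⁻ x, (‖G (Matrix.vecCons x Y)‖₊ : ℝ≥0∞) ^ 2) ≠ ⊤ →
      (∫⁻ x, (‖F (Matrix.vecCons x Y)‖₊ : ℝ≥0∞) ^ 2) ≠ ⊤ →
      ∀ κ : ℝ, 0 ≤ κ → κ ≤ 1 →
        ENNReal.ofReal κ ≤
          (‖∫ x, (starRingEnd ℂ) (constantMode L x) * G (Matrix.vecCons x Y)‖₊ : ℝ≥0∞) ^ 2 /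
            ∫⁻ x, (‖G (Matrix.vecCons x Y)‖₊ : ℝ≥0∞) ^ 2 →
        ENNReal.ofReal (1 - κ / 16) ≤
          (‖∫ x, (starRingEnd ℂ) (G (Matrix.vecCons x Y)) * F (Matrix.vecCons x Y)‖₊ : ℝ≥0∞) ^ 2 /
            ((∫⁻ x, (‖G (Matrix.vecCons x Y)‖₊ : ℝ≥0∞) ^ 2) *
              ∫⁻ x, (‖F (Matrix.vecCons x Y)‖₊ : ℝ≥0∞) ^ 2) →
        ENNReal.ofReal (κ / 4) ≤
          (‖∫ x, (starRingEnd ℂ) (constantMode L x) * F (Matrix.vecCons x Y)‖₊ : ℝ≥0∞) ^ 2 /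
            ∫⁻ x, (‖F (Matrix.vecCons x Y)‖₊ : ℝ≥0∞) ^ 2 := by
  intro n L G F Y hG hF hL hG2 hF2 κ hκ0 hκ1 h1 h2
  exact ft_functions (aestronglyMeasurable_constantMode L)
    (measurable_comp_vecCons_left hF Y).aestronglyMeasurable
    (measurable_comp_vecCons_left hG Y).aestronglyMeasurable (lintegral_constantMode_sq hL)
    hF2 hG2 hκ0 hκ1 h1 h2

end Summit.AtomisticToContinuum.BoseEinsteinCondensation.EntropySwap

end
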